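import Summits.QuantumFields.YangMills.Theorems.BalabanUVNodesN19RieszProductCosineFunctionals
import Summits.QuantumFields.YangMills.Theorems.BalabanUVNodesN19ArcsineRoad

/-!
# N19 (NE7, s3 ALTERNATIVE CURRENCY) — Uniform monomial closeness does NOT give absolute convergence of a fixed C¹ observable

Module 96 of the `dag-n19-e` lineage; settles CURRENCY-MAP v3 item (w′) in the NEGATIVE.

★★★ `exists_uniformMoments_geometric_fixedTest_not_summable`: for every `C > 0` and `0 < θ < 1` there
are probability laws `Λ_K` on `[−1,1]` whose MONOMIAL moments are ALL `Cθ^K`-close step to step,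
`|∫x^j dΛ_{K+1} − ∫x^j dΛ_K| ≤ Cθ^K` for every `j` and `K`, together with ONE continuously differentiable
observable `G` (`|G′| ≤ 1`, `1`-Lipschitz, `|G| ≤ 1` on `[−1,1]`) whose expectation increments are NOT
absolutely summable: `Σ_K |∫G dΛ_{K+1} − ∫G dΛ_K| = ∞`.  Compare module 89 (p616881): along the half-scale
ARC CHAINS every fixed Lipschitz observable converged absolutely; and module 90 (p611459): along EVERY
uniform-geometric sequence every observable with `Σ_j j|a_j| < ∞` (Chebyshev coefficients) converges
absolutely.  So under N19's uniform (monomial) target the absolute convergence of a fixed observable is a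
matter of SMOOTHNESS: true for `C^{2+ε}`-type observables, false for a (Baire-generic) `C¹` one.

MECHANISM.  The ARCSINE ROAD of module 95: toggling the level-`m` arcsine law on and off moves all
monomial moments by `≤ 2^{−m}` and pays `G_f(x) = ∫_0^x f(arccos 2y)dy` exactly
`|c_{m−1}(f) − c_{m+1}(f)|∕(4πm)`.  A LACUNARY SCHEDULE runs level `m_k = 4^{k+1}+2` for `2N_k`,
`N_k = ⌊ρ4^{k+1}⌋`, consecutive steps (`ρ = 3 log 2∕(16 log θ⁻¹)`, blocks `k ≥ k₀(C)`), which is affordable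
(`2^{−4^{k+1}} ≤ Cθ^K` throughout block `k`, §1) and collects `≍ Σ_k |c_{4^{k+1}+1}(f) − c_{4^{k+1}+3}(f)|`
— divergent for the bounded continuous `f` of module 94 (Riesz products + Banach–Steinhaus).

HONEST FRAMING: [folklore] real analysis over Mathlib and modules 94–95 BY NAME; TOY laws; the observable
is NON-CONSTRUCTIVE (uniform boundedness principle); no consumer in the DAG today; nothing of Bałaban's is
instantiated; NE7 is NOT PRINTED and NOT proved here; N19 is NOT discharged; count-neutral.  One finite 𝕋⁴
programme at fixed ε; nothing continuum ∕ OS ∕ mass-gap ∕ Clay.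
-/

open Real Finset MeasureTheory

namespace Summit.QuantumFields.YangMills.Theorems.BalabanUVNodesN19UniformMomentsFixedTestNotSummable

open BalabanUVNodesN19ArcsineRoad BalabanUVNodesN19RieszProductCosineFunctionals

/-! ## §1 The lacunary schedule: affordability and blocks [bookkeeping] -/

/-- `3·Σ_{i<K} 4^{i+1} = 4^{K+1} − 4` over `ℝ`. [bookkeeping] -/
theorem three_mul_sum_pow_four_real (K : ℕ) :
    3 * ∑ i ∈ range K, (4 : ℝ) ^ (i + 1) = 4 ^ (K + 1) - 4 := by
  induction K with
  | zero => simp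
  | succ K ih => rw [Finset.sum_range_succ, mul_add, ih]; ring

/-- AFFORDABILITY BY LOGARITHMS: if `T·log θ⁻¹ ≤ (log 2∕2)·4^{k+1}` and `−log C ≤ (log 2∕2)·4^{k+1}` then
`(½)^{4^{k+1}} ≤ C·θ^T`. [bookkeeping] -/
theorem half_pow_le_of_log {C θ : ℝ} (hC : 0 < C) (hθ0 : 0 < θ) {k T : ℕ}
    (hT : (T : ℝ) * Real.log θ⁻¹ ≤ Real.log 2 / 2 * 4 ^ (k + 1))
    (hk : -Real.log C ≤ Real.log 2 / 2 * 4 ^ (k + 1)) :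
    (1 / 2 : ℝ) ^ (4 ^ (k + 1)) ≤ C * θ ^ T := by
  rw [← Real.log_le_log_iff (by positivity) (by positivity), Real.log_pow, Real.log_mul hC.ne' (by positivity),
    Real.log_pow, one_div, Real.log_inv]
  rw [Real.log_inv] at hT
  push_cast
  nlinarith [Real.log_pos (by norm_num : (1 : ℝ) < 2)]

/-- BLOCKS OF A MONOTONE SCHEDULE: every index `K` lies in a block `[T_b, T_{b+1})`. [bookkeeping] -/
theorem exists_block {T : ℕ → ℕ} (hT0 : T 0 = 0) (hunb : ∀ K, ∃ k, K < T (k + 1)) (K : ℕ) :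
    ∃ b, T b ≤ K ∧ K < T (b + 1) := by
  classical
  refine ⟨Nat.find (hunb K), ?_, Nat.find_spec (hunb K)⟩
  rcases Nat.eq_zero_or_pos (Nat.find (hunb K)) with h | h
  · rw [h, hT0]; exact Nat.zero_le _
  · obtain ⟨b, hb⟩ := Nat.exists_eq_add_of_lt h
    have hmin := Nat.find_min (hunb K) (m := b) (by omega)
    rw [show Nat.find (hunb K) = b + 1 by omega]
    exact not_lt.1 hmin

/-- The block of an index is unique. [bookkeeping] -/
theorem block_unique {T : ℕ → ℕ} (hT : Monotone T) {K b b' : ℕ}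
    (h1 : T b ≤ K ∧ K < T (b + 1)) (h2 : T b' ≤ K ∧ K < T (b' + 1)) : b = b' := by
  by_contra hne
  rcases lt_or_gt_of_ne hne with h | h
  · have := hT (show b + 1 ≤ b' by omega); omega
  · have := hT (show b' + 1 ≤ b by omega); omega

/-- Summing over the first `k₁` blocks. [bookkeeping] -/
theorem sum_range_eq_sum_blocks {T : ℕ → ℕ} (hT : Monotone T) (hT0 : T 0 = 0) (a : ℕ → ℝ) (k₁ : ℕ) :
    ∑ K ∈ range (T k₁), a K = ∑ k ∈ range k₁, ∑ K ∈ Ico (T k) (T (k + 1)), a K := by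
  induction k₁ with
  | zero => simp [hT0]
  | succ k₁ ih =>
    rw [Finset.sum_range_succ, ← ih, Finset.range_eq_Ico, Finset.range_eq_Ico,
      Finset.sum_Ico_consecutive _ (Nat.zero_le _) (hT (Nat.le_succ _))]

/-! ## §2 The theorem -/

/-- ★★★ **UNDER UNIFORM MONOMIAL-MOMENT MATCHING AT GEOMETRIC CLOSENESS, A FIXED C¹ OBSERVABLE NEED NOT
CONVERGE ABSOLUTELY.**  For every `C > 0`, `0 < θ < 1` there are probability laws `Λ_K` on `[−1,1]` with
`|∫x^j dΛ_{K+1} − ∫x^j dΛ_K| ≤ Cθ^K` for ALL `j, K`, and a continuously differentiable `G : ℝ → ℝ` with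
`|G′| ≤ 1`, `|G(x) − G(y)| ≤ |x − y|`, `|G| ≤ 1` on `[−1,1]`, such that
`Σ_K |∫G dΛ_{K+1} − ∫G dΛ_K|` DIVERGES.  (Arcsine road of module 95 along a lacunary schedule, against the
Banach–Steinhaus function of module 94; CURRENCY-MAP v3 (w′) answered NO.) [folklore] -/
theorem exists_uniformMoments_geometric_fixedTest_not_summable {C θ : ℝ} (hC : 0 < C) (hθ0 : 0 < θ) (hθ1 : θ < 1) :
    ∃ Λ : ℕ → Measure ℝ, (∀ K, IsProbabilityMeasure (Λ K)) ∧ (∀ K, Λ K (Set.Icc (-1 : ℝ) 1)ᶜ = 0) ∧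
      (∀ K j : ℕ, |∫ x, x ^ j ∂Λ (K + 1) - ∫ x, x ^ j ∂Λ K| ≤ C * θ ^ K) ∧
      ∃ G : ℝ → ℝ, ContDiff ℝ 1 G ∧ (∀ x, |deriv G x| ≤ 1) ∧
        (∀ x y : ℝ, |G x - G y| ≤ 1 * |x - y|) ∧ (∀ x : ℝ, x ∈ Set.Icc (-1 : ℝ) 1 → |G x| ≤ 1) ∧
        ¬ Summable (fun K => |∫ x, G x ∂Λ (K + 1) - ∫ x, G x ∂Λ K|) := by
  classical
  -- the Banach–Steinhaus function and its observable
  obtain ⟨f, hfc, hfb, hfns⟩ := exists_continuous_lacunaryCoeffDiff_not_summable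
  set G : ℝ → ℝ := fun u => ∫ y in (0 : ℝ)..u, f (Real.arccos (2 * y)) with hGdef
  have hGc : Continuous G := (contDiff_obsOf hfc).1.continuous
  -- the arcsine laws
  obtain ⟨Λ, hprob, hsupp, hform⟩ := exists_arcsineLaws
  -- the schedule
  set L : ℝ := Real.log θ⁻¹ with hL
  have hLpos : 0 < L := Real.log_pos ((one_lt_inv₀ hθ0).2 hθ1)
  have hlog2 : 0 < Real.log 2 := Real.log_pos (by norm_num)
  set ρ : ℝ := 3 * Real.log 2 / (16 * L) with hρ
  have hρpos : 0 < ρ := by positivity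
  obtain ⟨k₀, hk₀⟩ : ∃ k₀ : ℕ, -Real.log C ≤ Real.log 2 / 2 * 4 ^ (k₀ + 1) := by
    obtain ⟨n, hn⟩ := pow_unbounded_of_one_lt (-Real.log C / (Real.log 2 / 2)) (by norm_num : (1 : ℝ) < 4)
    refine ⟨n, ?_⟩
    rw [div_lt_iff₀ (by positivity)] at hn
    have : (4 : ℝ) ^ n ≤ 4 ^ (n + 1) := pow_le_pow_right₀ (by norm_num) (by omega)
    nlinarith
  set N : ℕ → ℕ := fun k => if k₀ ≤ k then ⌊ρ * 4 ^ (k + 1)⌋₊ else 0 with hN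
  set T : ℕ → ℕ := fun k => ∑ i ∈ range k, 2 * N i with hT
  have hT0 : T 0 = 0 := by simp [hT]
  have hTmono : Monotone T := by
    refine monotone_nat_of_le_succ fun k => ?_
    simp only [hT, Finset.sum_range_succ]; omega
  have hTsucc : ∀ k, T (k + 1) = T k + 2 * N k := fun k => by simp only [hT, Finset.sum_range_succ]
  -- the schedule is affordable: `T(k+1)·L ≤ (log 2 ∕ 2)·4^{k+1}`
  have hNle : ∀ k, (N k : ℝ) ≤ ρ * 4 ^ (k + 1) := fun k => by
    simp only [hN]
    split_ifs
    · exact Nat.floor_le (by positivity)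
    · push_cast; positivity
  have hTle : ∀ k, (T (k + 1) : ℝ) * L ≤ Real.log 2 / 2 * 4 ^ (k + 1) := by
    intro k
    have h1 : (T (k + 1) : ℝ) ≤ 2 * ρ * ∑ i ∈ range (k + 1), (4 : ℝ) ^ (i + 1) := by
      simp only [hT]; push_cast
      rw [Finset.mul_sum]
      exact Finset.sum_le_sum fun i _ => by nlinarith [hNle i]
    have h2 := three_mul_sum_pow_four_real (k + 1)
    have h3 : (T (k + 1) : ℝ) ≤ 2 * ρ * (4 ^ (k + 2) / 3) := by nlinarith
    have h4 : 2 * ρ * ((4 : ℝ) ^ (k + 2) / 3) * L = Real.log 2 / 2 * 4 ^ (k + 1) := by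
      rw [hρ]; field_simp; ring
    nlinarith
  -- blocks are unbounded: every index gets a block
  have hunb : ∀ K : ℕ, ∃ k, K < T (k + 1) := by
    intro K
    obtain ⟨n, hn⟩ := pow_unbounded_of_one_lt ((K + 1 : ℝ) / ρ) (by norm_num : (1 : ℝ) < 4)
    refine ⟨max n k₀, ?_⟩
    rw [hTsucc]
    have hk : k₀ ≤ max n k₀ := le_max_right _ _
    have hNk : K + 1 ≤ N (max n k₀) := by
      simp only [hN, if_pos hk]
      refine Nat.le_floor ?_
      rw [div_lt_iff₀ hρpos] at hn
      have : (4 : ℝ) ^ n ≤ 4 ^ (max n k₀ + 1) := pow_le_pow_right₀ (by norm_num) (by omega)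
      push_cast; nlinarith
    omega
  choose blk hblk using exists_block hT0 hunb
  have hblk_ge : ∀ K, k₀ ≤ blk K := fun K => by
    by_contra h
    have : T (blk K + 1) = 0 := by
      simp only [hT]
      refine Finset.sum_eq_zero fun i hi => ?_
      have : ¬ k₀ ≤ i := by have := Finset.mem_range.1 hi; omega
      simp [hN, this]
    have := (hblk K).2; omega
  have hblk_eq : ∀ {K k : ℕ}, T k ≤ K → K < T (k + 1) → blk K = k := fun h1 h2 => block_unique hTmono (hblk _) ⟨h1, h2⟩
  -- the levels `m_k = 4^{k+1} + 2` and the law sequence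
  set lev : ℕ → ℕ := fun k => 4 ^ (k + 1) + 2 with hlev
  have hlev1 : ∀ k, 1 ≤ lev k := fun k => Nat.succ_le_of_lt (by positivity)
  set B : Measure ℝ := Λ 1 0 with hB
  set μ : ℕ → Measure ℝ := fun K => if Even K then B else Λ (lev (blk K)) 1 with hμ
  have hs1 : |(1 : ℝ)| ≤ 1 := by simp
  have hs0 : |(0 : ℝ)| ≤ 1 := by simp
  -- base swap: `Λ m 0` integrates continuous functions like `B`
  have hbase : ∀ (m : ℕ) (F : ℝ → ℝ), Continuous F → ∫ x, F x ∂(Λ m 0) = ∫ x, F x ∂B := by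
    intro m F hF
    rw [hB, hform m 0 F hs0 hF, hform 1 0 F hs0 hF]
    simp
  -- one toggle of level `lev k`: moments and payment
  have hmom : ∀ (k j : ℕ), |∫ x, x ^ j ∂(Λ (lev k) 1) - ∫ x, x ^ j ∂B| ≤ (1 / 2 : ℝ) ^ (4 ^ (k + 1)) := by
    intro k j
    rw [← hbase (lev k) _ (continuous_pow j)]
    refine ((abs_moment_sub_le hform (lev k) hs1 j).2.trans ?_)
    rw [abs_one, one_mul]
    exact pow_le_pow_of_le_one (by norm_num) (by norm_num) (by simp only [hlev]; exact Nat.le_add_right _ _)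
  set d : ℕ → ℝ := fun k => (∫ φ in (0 : ℝ)..π, f φ * Real.cos (((4 : ℝ) ^ (k + 1) + 1) * φ)) -
    ∫ φ in (0 : ℝ)..π, f φ * Real.cos (((4 : ℝ) ^ (k + 1) + 3) * φ) with hd
  have hpay : ∀ k : ℕ, |∫ x, G x ∂(Λ (lev k) 1) - ∫ x, G x ∂B| = |d k| / (4 * π * (4 ^ (k + 1) + 2)) := by
    intro k
    rw [← hbase (lev k) _ hGc, integral_sub_eq hform (lev k) hs1 hGc]
    have hcast : ((lev k : ℕ) : ℝ) = ((4 : ℝ) ^ (k + 1) + 1) + 1 := by simp only [hlev]; push_cast; ring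
    have key := integral_obsOf_comp_mul_cos hfc (4 ^ (k + 1) + 1)
    push_cast at key
    rw [hcast, hGdef, key]
    have e3 : ((4 : ℝ) ^ (k + 1) + 1 + 2) = (4 : ℝ) ^ (k + 1) + 3 := by ring
    rw [e3]
    simp only [hd]
    rw [abs_mul, abs_div, abs_div, abs_one, abs_of_pos Real.pi_pos,
      abs_of_pos (by positivity : (0 : ℝ) < 4 * ((4 : ℝ) ^ (k + 1) + 1 + 1))]
    field_simp
    ring
  -- the increments along the sequence, block by block
  have hincr_even : ∀ K, Even K → μ K = B ∧ μ (K + 1) = Λ (lev (blk (K + 1))) 1 := fun K hK => by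
    have hK1 : ¬ Even (K + 1) := Nat.not_even_iff_odd.2 (Even.add_one hK)
    constructor
    · simp only [hμ, if_pos hK]
    · simp only [hμ, if_neg hK1]
  have hincr_odd : ∀ K, ¬ Even K → μ K = Λ (lev (blk K)) 1 ∧ μ (K + 1) = B := fun K hK => by
    have hK1 : Even (K + 1) := by
      rcases Nat.even_or_odd K with h | h
      · exact absurd h hK
      · exact h.add_one
    constructor
    · simp only [hμ, if_neg hK]
    · simp only [hμ, if_pos hK1]
  refine ⟨μ, fun K => ?_, fun K => ?_, fun K j => ?_, G, (contDiff_obsOf hfc).1, fun x => ?_, fun x y => ?_,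
    fun x hx => ?_, fun hsum => hfns ?_⟩
  · -- probability
    simp only [hμ]; split_ifs
    · rw [hB]; exact hprob 1 0 le_rfl hs0
    · exact hprob _ 1 (hlev1 _) hs1
  · -- support
    simp only [hμ]; split_ifs
    · rw [hB]; exact hsupp 1 0
    · exact hsupp _ 1
  · -- uniform monomial closeness
    rcases Nat.even_or_odd K with hK | hK
    · obtain ⟨h0, h1⟩ := hincr_even K hK
      rw [h0, h1]
      refine (hmom _ j).trans ?_
      have hKT : K < T (blk (K + 1) + 1) := lt_of_le_of_lt (Nat.le_succ K) (hblk (K + 1)).2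
      refine (half_pow_le_of_log hC hθ0 (hTle _) ?_).trans ?_
      · exact hk₀.trans (mul_le_mul_of_nonneg_left (pow_le_pow_right₀ (by norm_num)
          (by have := hblk_ge (K + 1); omega)) (by positivity))
      · exact mul_le_mul_of_nonneg_left (pow_le_pow_of_le_one hθ0.le hθ1.le hKT.le) hC.le
    · obtain ⟨h0, h1⟩ := hincr_odd K (Nat.not_even_iff_odd.2 hK)
      rw [h0, h1, abs_sub_comm]
      refine (hmom _ j).trans ?_
      have hKT : K < T (blk K + 1) := (hblk K).2
      refine (half_pow_le_of_log hC hθ0 (hTle _) ?_).trans ?_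
      · exact hk₀.trans (mul_le_mul_of_nonneg_left (pow_le_pow_right₀ (by norm_num)
          (by have := hblk_ge K; omega)) (by positivity))
      · exact mul_le_mul_of_nonneg_left (pow_le_pow_of_le_one hθ0.le hθ1.le hKT.le) hC.le
  · -- |G′| ≤ 1
    rw [(contDiff_obsOf hfc).2]; exact hfb _
  · -- Lipschitz
    exact (abs_obsOf_sub_le hfc hfb x y).1
  · -- |G| ≤ 1 on [−1,1]
    refine (abs_obsOf_sub_le hfc hfb x x).2.trans ?_
    rw [one_mul]; exact abs_le.2 ⟨by linarith [hx.1], hx.2⟩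
  · -- NOT summable: block sums dominate the lacunary coefficient differences
    set a : ℕ → ℝ := fun K => |∫ x, G x ∂μ (K + 1) - ∫ x, G x ∂μ K| with ha
    have ha_nonneg : ∀ K, 0 ≤ a K := fun K => abs_nonneg _
    -- inside block `k` every increment pays `pay k`
    have hblock : ∀ k K, K ∈ Ico (T k) (T (k + 1)) → a K = |d k| / (4 * π * (4 ^ (k + 1) + 2)) := by
      intro k K hK
      rw [Finset.mem_Ico] at hK
      simp only [ha]
      rcases Nat.even_or_odd K with hKe | hKo
      · obtain ⟨h0, h1⟩ := hincr_even K hKe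
        -- `K + 1 < T (k+1)` since both `K` and `T (k+1)` are even
        have hTe : Even (T (k + 1)) := by simp only [hT]; exact Finset.even_sum _ fun i _ => even_two_mul _
        have hK1 : K + 1 < T (k + 1) := by
          rcases hTe with ⟨t, ht⟩; rcases hKe with ⟨u, hu⟩; omega
        rw [h0, h1, hblk_eq (by omega) hK1, hpay]
      · obtain ⟨h0, h1⟩ := hincr_odd K (Nat.not_even_iff_odd.2 hKo)
        rw [h0, h1, hblk_eq hK.1 hK.2, abs_sub_comm, hpay]
    have hblocksum : ∀ k, ∑ K ∈ Ico (T k) (T (k + 1)), a K = 2 * N k * (|d k| / (4 * π * (4 ^ (k + 1) + 2))) := by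
      intro k
      rw [Finset.sum_congr rfl (hblock k), Finset.sum_const, Nat.card_Ico, hTsucc, Nat.add_sub_cancel_left,
        nsmul_eq_mul]
      push_cast; ring
    -- large blocks: `2 N_k ≥ ρ 4^{k+1}` once `ρ 4^{k+1} ≥ 2` and `k ≥ k₀`
    obtain ⟨k₁, hk₁⟩ : ∃ k₁ : ℕ, 2 ≤ ρ * 4 ^ (k₁ + 1) := by
      obtain ⟨n, hn⟩ := pow_unbounded_of_one_lt (2 / ρ) (by norm_num : (1 : ℝ) < 4)
      refine ⟨n, ?_⟩
      rw [div_lt_iff₀ hρpos] at hn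
      have : (4 : ℝ) ^ n ≤ 4 ^ (n + 1) := pow_le_pow_right₀ (by norm_num) (by omega)
      nlinarith
    set kstar : ℕ := max k₀ k₁ with hkstar
    have hbig : ∀ k, kstar ≤ k → ρ / (12 * π) * |d k| ≤ ∑ K ∈ Ico (T k) (T (k + 1)), a K := by
      intro k hk
      rw [hblocksum]
      have hk0 : k₀ ≤ k := le_trans (le_max_left _ _) hk
      have hρk : 2 ≤ ρ * 4 ^ (k + 1) :=
        hk₁.trans (mul_le_mul_of_nonneg_left (pow_le_pow_right₀ (by norm_num)
          (by have := le_max_right k₀ k₁; omega)) hρpos.le)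
      have hNk : ρ * 4 ^ (k + 1) ≤ 2 * (N k : ℝ) := by
        simp only [hN, if_pos hk0]
        have := Nat.lt_floor_add_one (ρ * 4 ^ (k + 1))
        linarith
      have h4 : (0 : ℝ) < 4 ^ (k + 1) := by positivity
      rw [div_mul_eq_mul_div, div_le_iff₀ (by positivity)]
      have hd0 := abs_nonneg (d k)
      calc ρ * |d k| = ρ * 4 ^ (k + 1) * (|d k| / 4 ^ (k + 1)) := by field_simp
        _ ≤ 2 * (N k : ℝ) * (|d k| / 4 ^ (k + 1)) := mul_le_mul_of_nonneg_right hNk (by positivity)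
        _ = 2 * (N k : ℝ) * (|d k| / (4 * π * (4 ^ (k + 1) + 2))) * (4 * π * ((4 ^ (k + 1) + 2) / 4 ^ (k + 1))) := by
            field_simp
        _ ≤ 2 * (N k : ℝ) * (|d k| / (4 * π * (4 ^ (k + 1) + 2))) * (12 * π) := by
            refine mul_le_mul_of_nonneg_left ?_ (by positivity)
            have : ((4 : ℝ) ^ (k + 1) + 2) / 4 ^ (k + 1) ≤ 3 := by
              rw [div_le_iff₀ h4]
              have : (4 : ℝ) ≤ 4 ^ (k + 1) := by
                calc (4 : ℝ) = 4 ^ 1 := by norm_num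
                  _ ≤ 4 ^ (k + 1) := pow_le_pow_right₀ (by norm_num) (by omega)
              linarith
            nlinarith [Real.pi_pos]
    -- bounded partial sums of `|d|` beyond `kstar`, contradiction with module 94
    have hpartial : ∀ n, ∑ i ∈ range n, |d (kstar + i)| ≤ (12 * π / ρ) * ∑' K, a K := by
      intro n
      have h1 : ∑ i ∈ range n, ρ / (12 * π) * |d (kstar + i)| ≤ ∑ k ∈ range (kstar + n), ∑ K ∈ Ico (T k) (T (k + 1)), a K := by
        rw [← Finset.sum_range_add_sum_Ico _ (Nat.le_add_right kstar n)]
        have h2 : ∑ i ∈ range n, ρ / (12 * π) * |d (kstar + i)| ≤ ∑ k ∈ Ico kstar (kstar + n), ∑ K ∈ Ico (T k) (T (k + 1)), a K := by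
          rw [Finset.sum_Ico_eq_sum_range, Nat.add_sub_cancel_left]
          exact Finset.sum_le_sum fun i _ => hbig _ (Nat.le_add_right _ _)
        have h3 : 0 ≤ ∑ k ∈ range kstar, ∑ K ∈ Ico (T k) (T (k + 1)), a K :=
          Finset.sum_nonneg fun k _ => Finset.sum_nonneg fun K _ => ha_nonneg K
        linarith
      rw [← sum_range_eq_sum_blocks hTmono hT0 a] at h1
      have h4 : ∑ K ∈ range (T (kstar + n)), a K ≤ ∑' K, a K :=
        hsum.sum_le_tsum (range _) fun K _ => ha_nonneg K
      rw [← Finset.mul_sum] at h1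
      rw [div_mul_eq_mul_div, le_div_iff₀ hρpos]
      have := mul_le_mul_of_nonneg_left (h1.trans h4) (by positivity : (0 : ℝ) ≤ 12 * π)
      have e : 12 * π * (ρ / (12 * π) * ∑ i ∈ range n, |d (kstar + i)|) = (∑ i ∈ range n, |d (kstar + i)|) * ρ := by
        field_simp
      linarith
    have hshift : Summable fun i => |d (kstar + i)| :=
      summable_of_sum_range_le (fun i => abs_nonneg _) hpartial
    have hshift' : Summable fun i => |d (i + kstar)| := hshift.congr fun i => by rw [add_comm]
    have hdsum : Summable fun k => |d k| := (summable_nat_add_iff (f := fun k => |d k|) kstar).1 hshift'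
    simpa only [hd] using hdsum

end Summit.QuantumFields.YangMills.Theorems.BalabanUVNodesN19UniformMomentsFixedTestNotSummable
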